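import Summits.HubbardSuperconductivity.HubbardSuperconductivity.Theorems.SoloBlindEnergyBalance
import HarnessLib

/-!
# The crutched Rayleigh quotient of the weighted condensate (solo-blind programme, Theorem 28(d))

One inequality combining the kinetic bound and the gain bound of `SoloBlindEnergyBalance`: for the
number-projected condensate `Ψ = Ψ^φ_{A,M+2}` (weights `x = φ²`, signs of `φ` following the `d`-wave
profile `w`), a Fermi set `F ⊆ A` (`#F = M+2`) with separating level `μ`, the fugacity window, and
any `g_k ≥ 0` with `g_k²(1+x_k)(2+x_k) ≤ x_k`, the crutched free Hamiltonian
`H₀ + (-t)ΔᴴΔ` (`t ≥ 0`) satisfies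

  `re⟨Ψ, (H₀ + (-t)ΔᴴΔ)Ψ⟩ ≤ (2Σ_Fε + 2Σ_{A∖F}(ε-μ)·2x/(1+2x) + 2Σ_F(μ-ε)·2/(2+x) - t(Σ_A|w|g)²)·‖Ψ‖²`.

With `SoloBlindReciprocalBlocks.blocks_fugacity_window` (the window from reciprocal block weights)
and `SoloBlindVariationalCrutch` (order from a trial state), what remains of claim C53 is the choice
of blocks on the dyadic Fermi-surface windows and the Cooper-logarithm arithmetic (report §5.20 (6),
items E5c/E6b(ii)). [this work]
-/

noncomputable section

namespace Summit.HubbardSuperconductivity.HubbardSuperconductivity.Theorems.EnergyBalance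

open Matrix Finset Literature.Probability.LatticeModels
  Literature.MathematicalPhysics.QuantumLattice
  Summit.HubbardSuperconductivity.HubbardSuperconductivity.Theorems.PairCondensate
  Summit.HubbardSuperconductivity.HubbardSuperconductivity.Theorems.WeightedCondensate
open scoped ComplexOrder ComplexConjugate

variable {L : ℕ} [NeZero L]

/-- `esy[x, s, j]` = the `j`-th elementary symmetric sum of the weights `x` over `s`. -/
local notation "esy[" x ", " s ", " j "]" =>
  (∑ t ∈ Finset.powersetCard j s, ∏ k ∈ t, x k)

local notation "Φ[" S "]" =>
  (List.prod (List.map (fun k : TorusSite 2 _ => (pairMode k)ᴴ) (Finset.toList S)) *ᵥ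
    (vacuum : Fock (Orb (FermionTorus 2 _))))

/-- The `d`-wave profile `w_k = pairFieldMode dWaveFormFactor L k`. -/
local notation "W[" k "]" => (pairFieldMode dWaveFormFactor _ k)

/-- The weighted number-projected condensate. -/
local notation "Ψ[" φ ", " A " ; " i "]" =>
  (∑ S ∈ Finset.powersetCard i A, ((((∏ k ∈ S, φ k : ℝ))) : ℂ) • Φ[S])

omit [NeZero L] in
/-- `re⟨v,(H + cO)v⟩ = re⟨v,Hv⟩ + c·re⟨v,Ov⟩` for real `c`. [folklore] -/
private theorem re_rayleigh_add_ofReal_smul' {ι : Type*} [Fintype ι] (H O : Matrix ι ι ℂ) (c : ℝ)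
    (v : ι → ℂ) : (star v ⬝ᵥ (H + (c : ℂ) • O) *ᵥ v).re =
      (star v ⬝ᵥ H *ᵥ v).re + c * (star v ⬝ᵥ O *ᵥ v).re := by
  rw [add_mulVec, smul_mulVec, dotProduct_add, dotProduct_smul, Complex.add_re, smul_eq_mul,
    Complex.re_ofReal_mul]

/-- **Theorem 28(d) (crutched Rayleigh quotient of the weighted condensate).** [this work] -/
theorem trial_bracket (hL : 3 ≤ L) (φ g : TorusSite 2 L → ℝ) (A F : Finset (TorusSite 2 L))
    (hFA : F ⊆ A) (M : ℕ) (hF : #F = M + 2) (μ : ℝ)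
    (hsep : ∀ k ∈ F, torusBand L k ≤ μ) (hsep' : ∀ k ∈ A \ F, μ ≤ torusBand L k)
    (hC1 : 0 < esy[fun k => φ k ^ 2, A, M + 1]) (hC2 : 0 < esy[fun k => φ k ^ 2, A, M + 2])
    (hW1 : esy[fun k => φ k ^ 2, A, M + 2] < 2 * esy[fun k => φ k ^ 2, A, M + 1])
    (hW2 : esy[fun k => φ k ^ 2, A, M + 2] < 2 * esy[fun k => φ k ^ 2, A, M + 3])
    (hmono : esy[fun k => φ k ^ 2, A, M + 1] ≤ esy[fun k => φ k ^ 2, A, M + 2])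
    (hφW : ∀ k ∈ A, 0 ≤ W[k] * φ k) (hg0 : ∀ k ∈ A, 0 ≤ g k)
    (hg : ∀ k ∈ A, g k ^ 2 * ((1 + φ k ^ 2) * (2 + φ k ^ 2)) ≤ φ k ^ 2) {t : ℝ} (ht : 0 ≤ t) :
    (star Ψ[φ, A ; M + 2] ⬝ᵥ (hubbardTorus 2 L 1 0 + ((-t : ℝ) : ℂ) •
        ((pairField dWaveFormFactor L)ᴴ * pairField dWaveFormFactor L)) *ᵥ Ψ[φ, A ; M + 2]).re ≤
      (2 * ∑ k ∈ F, torusBand L k +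
          (2 * ∑ k ∈ A \ F, (torusBand L k - μ) * (2 * φ k ^ 2 / (1 + 2 * φ k ^ 2)) +
            2 * ∑ k ∈ F, (μ - torusBand L k) * (2 / (2 + φ k ^ 2))) -
          t * (∑ k ∈ A, |W[k]| * g k) ^ 2) *
        (star Ψ[φ, A ; M + 2] ⬝ᵥ Ψ[φ, A ; M + 2]).re := by
  rw [re_rayleigh_add_ofReal_smul', re_star_wcond_dotProduct_self]
  have hk := kinetic_le hL φ A F hFA M hF μ hsep hsep' hC1 hC2 hW1 hW2
  have hgain := gain_ge φ g A M hC1 hW1 hmono hφW hg0 hg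
  have h1 : ∑ k ∈ A \ F, (torusBand L k - μ) *
        (2 * φ k ^ 2 / (1 + 2 * φ k ^ 2) * esy[fun k => φ k ^ 2, A, M + 2]) =
      (∑ k ∈ A \ F, (torusBand L k - μ) * (2 * φ k ^ 2 / (1 + 2 * φ k ^ 2))) *
        esy[fun k => φ k ^ 2, A, M + 2] := by
    rw [sum_mul]
    exact sum_congr rfl fun k _ => by ring
  have h2 : ∑ k ∈ F, (μ - torusBand L k) * (2 / (2 + φ k ^ 2) * esy[fun k => φ k ^ 2, A, M + 2]) =
      (∑ k ∈ F, (μ - torusBand L k) * (2 / (2 + φ k ^ 2))) * esy[fun k => φ k ^ 2, A, M + 2] := by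
    rw [sum_mul]
    exact sum_congr rfl fun k _ => by ring
  rw [h1, h2] at hk
  have h3 : (-t) * (star Ψ[φ, A ; M + 2] ⬝ᵥ
        ((pairField dWaveFormFactor L)ᴴ * pairField dWaveFormFactor L) *ᵥ Ψ[φ, A ; M + 2]).re ≤
      (-t) * ((∑ k ∈ A, |W[k]| * g k) ^ 2 * esy[fun k => φ k ^ 2, A, M + 2]) :=
    mul_le_mul_of_nonpos_left hgain (by linarith)
  nlinarith [hk, h3]

end Summit.HubbardSuperconductivity.HubbardSuperconductivity.Theorems.EnergyBalance
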